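import Mathlib
import HarnessLib
import Summits.Ventures.LatticeQCDFlow.Exactness.SUNLeapfrogHMCEngine
import Summits.Ventures.LatticeQCDFlow.Exactness.MetropolisSweepInstances
import Summits.Ventures.LatticeQCDFlow.Exactness.WilsonHeatBathErgodic

/-!
# The engine's single-step HMC for the `SU(N)` Wilson action converges to the Wilson measure from every start, every `N`

HONEST FRAMING: exact (Metropolis-corrected) sampling algorithms for lattice gauge theory;
figures of merit are autocorrelation/cost numbers at stated couplings and volumes; no
continuum-physics claim.

Venture `LatticeQCDFlow` (cell pub-lqcd), topic `Exactness`, FANOUT row 9 (eng-latcore, the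
engine `latflow.core.hmc.HMC(f, β, 'leapfrog').trajectory(τ = ε, nstep = 1)` on the `SU(N)` Wilson
action of the torus `(ℤ/L)^d`, and its 2D twin `sun_2d.HMC2D`).  NEW WORK of the cell over the tree
(`SUNLeapfrogHMCEngine.lean`: the engine's nstep = 1 HMC on `SU(N)^links` is uniformly ergodic for
every bounded measurable action; `MetropolisSweepInstances.gibbsProbability_eq_wilsonMeasure`;
`WilsonHeatBathErgodic.continuous_smul_wilsonAction`).  The Wilson action and measure are the
Literature definitions of `ConstructiveQFTWave0` (`wilsonAction`, `wilsonMeasure`), used by name;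
nothing is cited as a fact.  The `SU(N)` twin of `SU2LeapfrogHMCWilson.lean`.

* `exists_bound_smul_wilsonAction_sun` — `β S_W` is bounded on the compact configuration space
  (continuous representation `ρ`);
* **`wilson_sunLeapfrogHMC_uniformlyErgodic`** — torus `(ℤ/L)^d`, `G = SU(N)` (`N ≥ 1`), continuous
  `ρ`, any real `β`, step `ε > 0`, the engine's momenta / kinetic term `−tr P²`, ANY measurable momentum
  increment bounded by `b ≥ 0` (the engine's `−½ε∂S` is one): there are `k` and `δ ∈ (0, 1]` with
  `|μ₀Kᵗ(A) − wilsonMeasure ρ β (A)| ≤ (1 − δ)^{⌊t/(k+1)⌋}` for EVERY initial law `μ₀`, every `t`, `A`;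
* **`wilsonMeasure_unique_invariant_sunLeapfrogHMC`** — the Wilson measure is the ONLY invariant
  probability law of that kernel.

NOT CLAIMED: `nstep ≥ 2`, OMF words, `tau_jitter`; any usable constant; floating point; that the
engine's force routine is the gradient of `β S_W` (irrelevant to the statement: any bounded
measurable increment is covered).
-/

noncomputable section

namespace Summit.Ventures.LatticeQCDFlow.Exactness

open MeasureTheory ProbabilityTheory ProbabilityTheory.Kernel Set
open Literature.MathematicalPhysics.QuantumFieldTheory
open scoped ENNReal

section Wilson

variable (N : ℕ) [NeZero N] {d L M : ℕ} (ρ : Matrix.specialUnitaryGroup (Fin N) ℂ →* Matrix (Fin M) (Fin M) ℂ)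

omit [NeZero N] in
/-- **The scaled Wilson action is bounded** on the compact configuration space `SU(N)^E` (it is
continuous, `continuous_smul_wilsonAction`). -/
theorem exists_bound_smul_wilsonAction_sun [NeZero L] (hρ : Continuous ρ) (β : ℝ) :
    ∃ s : ℝ, ∀ U : GaugeConfig d L (Matrix.specialUnitaryGroup (Fin N) ℂ), |β * wilsonAction ρ U| ≤ s := by
  have hc : Continuous fun U : GaugeConfig d L (Matrix.specialUnitaryGroup (Fin N) ℂ) =>
      |β * wilsonAction ρ U| := continuous_abs.comp (continuous_smul_wilsonAction ρ hρ β)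
  obtain ⟨U₀, -, hmax⟩ := isCompact_univ.exists_isMaxOn univ_nonempty hc.continuousOn
  exact ⟨|β * wilsonAction ρ U₀|, fun U => (isMaxOn_iff.1 hmax) U (mem_univ U)⟩

omit [NeZero N] in
/-- The Gibbs law of `β S_W` in the HMC files' spelling is the Literature Wilson measure. -/
theorem gibbsProbability_smul_wilsonAction_eq [NeZero L] (β : ℝ) :
    gibbsProbability (Measure.pi fun _ : Edge d L => haarProbability (Matrix.specialUnitaryGroup (Fin N) ℂ))
        (fun U : GaugeConfig d L (Matrix.specialUnitaryGroup (Fin N) ℂ) => Real.exp (-(β * wilsonAction ρ U))) =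
      wilsonMeasure (d := d) (L := L) ρ β := by
  have h : (fun U : GaugeConfig d L (Matrix.specialUnitaryGroup (Fin N) ℂ) => Real.exp (-(β * wilsonAction ρ U))) =
      fun U => Real.exp (-β * wilsonAction ρ U) := by
    funext U; rw [neg_mul]
  rw [h]
  exact gibbsProbability_eq_wilsonMeasure (d := d) (L := L) ρ β

/-- **THE ENGINE'S SINGLE-STEP LEAPFROG HMC CONVERGES TO THE `SU(N)` WILSON MEASURE FROM EVERY START.**
Torus `(ℤ/L)^d`, `G = SU(N)`, continuous representation `ρ`, any real `β`; one P-first leapfrog step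
of size `ε > 0`, the engine's momenta (coordinates `sunCoordι`, kinetic term `sunKinetic = −Σ tr P²`,
Gaussian refresh), ANY measurable momentum increment bounded by `b ≥ 0`, Metropolis test on
`β S_W + T`: there are `k` and `δ ∈ (0, 1]` with
`|μ₀Kᵗ(A) − wilsonMeasure ρ β (A)| ≤ (1 − δ)^{⌊t/(k+1)⌋}` for EVERY initial law `μ₀`, every `t`, `A`. -/
theorem wilson_sunLeapfrogHMC_uniformlyErgodic [NeZero L] (hρ : Continuous ρ) (β : ℝ) {ε : ℝ} (hε : 0 < ε)
    {g : GaugeConfig d L (Matrix.specialUnitaryGroup (Fin N) ℂ) → Edge d L → SUNCoords N}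
    (hg : Measurable g) {b : ℝ} (hb0 : 0 ≤ b) (hb : ∀ U e, ‖g U e‖ ≤ b) :
    ∃ k : ℕ, ∃ δ : ℝ, 0 < δ ∧ δ ≤ 1 ∧
      ∀ (μ₀ : Measure (GaugeConfig d L (Matrix.specialUnitaryGroup (Fin N) ℂ))) [IsProbabilityMeasure μ₀]
        (t : ℕ) (A : Set (GaugeConfig d L (Matrix.specialUnitaryGroup (Fin N) ℂ))),
        |((fun m : Measure (GaugeConfig d L (Matrix.specialUnitaryGroup (Fin N) ℂ)) =>
              m.bind (sunLeapfrogHMC (sunCoordι N) (sunCoordι_skew N) (Measure.addHaar : Measure (SUNCoords N))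
                (sunKinetic N) ε hg fun U => β * wilsonAction ρ U))^[t] μ₀).real A
            - (wilsonMeasure (d := d) (L := L) ρ β).real A| ≤ (1 - δ) ^ (t / (k + 1)) := by
  obtain ⟨s, hs⟩ := exists_bound_smul_wilsonAction_sun N (d := d) (L := L) ρ hρ β
  rw [← gibbsProbability_smul_wilsonAction_eq N (d := d) (L := L) ρ β]
  exact engine_sunLeapfrogHMC_uniformlyErgodic N hε hg hb0 hb (continuous_smul_wilsonAction ρ hρ β).measurable hs

/-- **The Wilson measure is the unique invariant probability law of the engine's single-step leapfrog
HMC** on `SU(N)` lattice gauge fields (same hypotheses). -/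
theorem wilsonMeasure_unique_invariant_sunLeapfrogHMC [NeZero L] (hρ : Continuous ρ) (β : ℝ) {ε : ℝ}
    (hε : 0 < ε) {g : GaugeConfig d L (Matrix.specialUnitaryGroup (Fin N) ℂ) → Edge d L → SUNCoords N}
    (hg : Measurable g) {b : ℝ} (hb0 : 0 ≤ b) (hb : ∀ U e, ‖g U e‖ ≤ b)
    {π' : Measure (GaugeConfig d L (Matrix.specialUnitaryGroup (Fin N) ℂ))} [IsProbabilityMeasure π']
    (hπ' : Invariant (sunLeapfrogHMC (sunCoordι N) (sunCoordι_skew N) (Measure.addHaar : Measure (SUNCoords N))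
      (sunKinetic N) ε hg fun U => β * wilsonAction ρ U) π') :
    π' = wilsonMeasure (d := d) (L := L) ρ β := by
  obtain ⟨s, hs⟩ := exists_bound_smul_wilsonAction_sun N (d := d) (L := L) ρ hρ β
  rw [← gibbsProbability_smul_wilsonAction_eq N (d := d) (L := L) ρ β]
  exact engine_sunLeapfrogHMC_invariant_unique N hε hg hb0 hb (continuous_smul_wilsonAction ρ hρ β).measurable hs hπ'

end Wilson

end Summit.Ventures.LatticeQCDFlow.Exactness
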